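import Mathlib
import HarnessLib
import Summits.HubbardSuperconductivity.HubbardSuperconductivity.Theorems.KLProgrammeKLRegimeSectorMultiplierSinglePaddedDiffs
import Summits.HubbardSuperconductivity.HubbardSuperconductivity.Theorems.KLProgrammeKLRegimeSectorMultiplierWtRates
import Summits.HubbardSuperconductivity.HubbardSuperconductivity.Theorems.KLProgrammeKLRegimeEngineTorusSumMomentMixed

/-!
# Route `KLProgramme` — engine support, route (L2): the UNIFORM WEIGHTED `ℓ¹` bound (one position moment) of the space-time character sum of ONE
# sector function `F_ω = klAnisoFamily … n ω` on an admissible frame, on the PADDED `4M`-grid `(ℤ/4M) × (ℤ/L)²` of the engine's torus sums — `Σ_z (1 + s₀|j̃| + s₁|z̃|₁)‖S_ω(z)‖ ≤ (C_W/√e₀)·M·L²`, `C_W` INDEPENDENT of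
# the scale, the sector, `β`, `L`, `M`

Cell `gate-hubbard-kl`, seat p3 (g10); W1 of the (E4)ₙ supply of stmt-HubbardSuperconductivity-20437 (located risk «(b)-Wt@j≥1», cure W1-MIXED,
KL STATUS 2026-08-27 15:19Z/16:51Z).  The weighted / single-multiplier twin of p4's `charSum_klAnisoPair_le_uniform` (`…SectorMultiplierBound`):
the pointwise inputs of `…SectorMultiplierSingleDiffs` (third differences in time, along the axes, along `v⊥` and along the tangent step `v` at the
ISOTROPIC rates `s₀ = 2Λβ/(2Mπ√c_G)`, `s₁ = 2Λ/(π√K)`, `s₂ = s₃' = 4Λ/(LU√K)`; second differences along `v` at `s₃ = 2Λ/(π√K)`, `√c_G = max 1 c_T`,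
`√K = max 1 (max κ₃ κ₂)` — no cube roots, `…SectorMultiplierWtRates`) fed into the mixed master lemma `sum_wt_norm_charSum_le_of_mixed_differences`,
then p4's factor bookkeeping (`tfac_le`, `near_perp_le`, `near_tan_le`, `far_le`, `bracket_le`, `supp_le`, `sqrt_mul_sqrt_le` at `κ := K`) with the
moment constant `C_w' ≤ 1 + 12√2` (`cw_ratio_le`) and the bracket conversion `bracketWt_le`:

  **`charSumWt_klAnisoPadded_le_uniform`** — for every `n`, under `Λ_nβ < π(2M−5)`, `βe₀ ≤ M`, `3|2π/L|(2ⁿ+½) ≤ z`, `2π·16ⁿ ≤ L`,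
  `π/(4β) ≤ Λ_n` and the order-three frame datum `A₃·Λ_n² ≤ a₃`:
  `Σ_z (1 + s₀|j̃| + s₁|z̃₁| + s₁|z̃₂|)·‖Σ_q χχ • F_ω(k q)‖ ≤ √(a·b/e₀)·2M·L²`, `a = 524288(π√c_G+1)((1+12√2)²/4 + 1/16)κ_X`, `b = (240/π)c_{N,1}c_{N,2}`.

Everything is proved; no definitions, no named facts. [cite: BenfattoGiulianiMastropietro2006, Lemma 2.2 (2.52)–(2.55), §2.6 (2.81)]
-/

noncomputable section

namespace Summit.HubbardSuperconductivity.HubbardSuperconductivity.Theorems.TorusFourierL2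

set_option linter.dupNamespace false -- summit = problem name (single-conjunct summit), D-0017

open Set Finset Literature.MathematicalPhysics.QuantumLattice Literature.MathematicalPhysics.QuantumLattice.BandSectorCounting
open Literature.MathematicalPhysics.QuantumLattice.FermiRG Literature.Probability.LatticeModels Literature.Analysis.SpecialFunctions
open Summit.HubbardSuperconductivity.HubbardSuperconductivity.Theorems.DispersionFlow
open Summit.HubbardSuperconductivity.HubbardSuperconductivity.Theorems.KLRegimeSplit
open Summit.HubbardSuperconductivity.HubbardSuperconductivity.Theorems.KLProgrammeLegKernels
open Summit.HubbardSuperconductivity.HubbardSuperconductivity.Theorems.PerturbedFermiCurve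
open scoped Real ComplexConjugate

section Main
variable {L M : ℕ} [NeZero L] [NeZero M] {a b : ℝ} (B : BandBounds a b) {K : TrigPolyC4v} {A A₃ a₃ : ℝ}
  (hA : ∀ p : Momentum, ∀ j ≤ 2, ‖iteratedFDeriv ℝ j (frameShift K) p‖ ≤ A) (hADt : 2 * A < B.Dtmin)
  (hA3 : ∀ p : Momentum, ‖iteratedFDeriv ℝ 3 (frameShift K) p‖ ≤ A₃)
  {μ e₀ z β : ℝ} (he : 0 < e₀) (hz : 0 < z) (hz1 : z ≤ 1) (hgap : e₀ + A + z ^ 2 < -μ) (h3 : e₀ + A - μ ≤ 3)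
  (hlo : a ≤ μ - A - e₀) (hhi : μ + A + e₀ ≤ b) (hβ : 0 < β) (hρA : 4 * A < 2 * B.rhomin)
  {n : ℕ} (ω : Fin (sectorCount n))
  {d : ℝ} (hd : 0 < d) (hd1 : ∀ u, |deriv (bgmCutoffSq e₀) u| ≤ d) (hd2 : ∀ u, |iteratedDeriv 2 (bgmCutoffSq e₀) u| ≤ d)
  (hd3 : ∀ u, |iteratedDeriv 3 (bgmCutoffSq e₀) u| ≤ d)
  {Z : (Fin 2 → ℝ) → ℝ}
  (hZ : ∀ p, Z p = gnCutoff ((π + z) ^ 2 / π ^ 2) ((π + z) ^ 2) (p 0 ^ 2) * gnCutoff ((π + z) ^ 2 / π ^ 2) ((π + z) ^ 2) (p 1 ^ 2) *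
    (radialCutoffC (1 / 2) (momToComplex p) * sectorWeightCirc n ((ω : ℕ) : ℤ) (polarAngle p)))
  {Φ : ℝ × (Fin 2 → ℝ) → ℂ}
  (hΦ : ∀ k₀ p, Φ (k₀, p) = ((bgmCutoffSq e₀ ((16 : ℝ) ^ n * (k₀ ^ 2 + frameLevel μ K (WithLp.toLp 2 p) ^ 2)) * Z p : ℝ) : ℂ))
  -- the angular constant of `exists_norm_iteratedDeriv_sectorWeightCirc_polarAngle_line_le 3`
  {Ba : ℝ} (hB0 : 0 < Ba)
  (hB : ∀ (i : ℕ), i ≤ 3 → ∀ (n : ℕ) (ω : ℤ) (θ₀ : ℝ) (q w : Fin 2 → ℝ) (t : ℝ) {r₀ : ℝ}, 0 < r₀ →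
    r₀ ≤ ‖momToComplex (q + t • w)‖ → |sectorRelAngle θ₀ (q + t • w)| < π →
    ‖iteratedDeriv i (fun t : ℝ => sectorWeightCirc n ω (polarAngle (q + t • w))) t‖ ≤
      (3 : ℕ).factorial * Ba * ((1 + (sectorWidth n)⁻¹ * (3 : ℕ).factorial) * ‖momToComplex w‖ / r₀) ^ i)
  -- the named constants (parameters with defining equations; instantiate with `rfl`)
  {cT κt ρb G₁ K₂ Y₃ κ₂ κ₃ κ Kc κX cN1 cN2 : ℝ}
  (hcT : cT = 8 * (d * e₀ ^ 6) + 12 * (d * e₀ ^ 4))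
  (hκt : κt = max 1 cT)
  (hρb : ρb = (e₀ + 3 * π / 2 * B.smax * B.Dtmin) / (B.Dtmin - 2 * A))
  (hG₁ : G₁ = 4 + 2 * A) (hK₂ : K₂ = 4 + 4 * A)
  (hY₃ : Y₃ = G₁ + 3 / 2 * K₂ * ρb + 9 / 2 * K₂)
  (hκ₂ : κ₂ = (4 * (d * e₀ ^ 4) + 2 * (d * e₀ ^ 2)) * Y₃ ^ 2 + 9 / 2 * (d * e₀ ^ 2) * K₂ * e₀ + 216 * (d * e₀ ^ 2) * Ba * Y₃ * e₀ +
    486 * Ba * e₀ ^ 2)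
  (hκ₃ : κ₃ = (8 * (d * e₀ ^ 6) + 12 * (d * e₀ ^ 4)) * G₁ ^ 3 + (12 * (d * e₀ ^ 4) + 6 * (d * e₀ ^ 2)) * G₁ * K₂ * e₀ +
    2 * (d * e₀ ^ 2) * (4 * e₀ ^ 2 + 8 * a₃) +
    108 * Ba * ((4 * (d * e₀ ^ 4) + 2 * (d * e₀ ^ 2)) * G₁ ^ 2 * e₀ + 2 * (d * e₀ ^ 2) * K₂ * e₀ ^ 2) +
    1296 * (d * e₀ ^ 2) * G₁ * Ba * e₀ ^ 2 + 1296 * Ba * e₀ ^ 3)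
  (hκ : κ = max 1 (max κ₃ κ₂)) (hKc : Kc = κ ^ 2)
  (hκX : κX = 4 * (3 * Real.sqrt 2 * π * Real.sqrt Kc + 2 * e₀) ^ 2 / e₀ +
    96 / (π * e₀ ^ 2) * ((π * Real.sqrt Kc / 2) * (π * Real.sqrt Kc / 2 + e₀) ^ 2))
  (hcN1 : cN1 = Real.sqrt 2 * (e₀ + (4 + 4 * A) * ρb ^ 2) / ((2 * B.rhomin - 4 * A) * π) + 2)
  (hcN2 : cN2 = 2 * Real.sqrt 2 * ρb / π + 2)

set_option maxHeartbeats 6000000 in -- large explicit constants: elaboration of the symbol-layer bounds and their packaging is slow (as p4's pair file)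
include B hA hADt hA3 he hz hz1 hgap h3 hlo hhi hβ hρA hd hd1 hd2 hd3 hZ hΦ hB0 hB hcT hκt hρb hG₁ hK₂ hY₃ hκ₂ hκ₃ hκ hKc hκX hcN1 hcN2 in
/-- **The uniform WEIGHTED `ℓ¹` bound of the space-time character sum of one sector function `F_ω` on an admissible frame**:
`Σ_z (1 + s₀|j̃| + s₁|z̃₁| + s₁|z̃₂|)·‖S_ω(z)‖ ≤ √(a·b/e₀)·2M·L²` with `s₀ = 2Λ_nβ/(4Mπκ_t)`, `s₁ = 2Λ_n/(πκ)` and `a, b` as in the header — uniform in the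
scale `n`, the sector, `β ∈ [π/(4Λ_n), M/e₀]` and the volume, given the order-three frame datum `A₃Λ_n² ≤ a₃`.
[cite: BenfattoGiulianiMastropietro2006, Lemma 2.2 (2.52)–(2.55), §2.6 (2.81)] -/
theorem charSumWt_klAnisoPadded_le_uniform (ha3 : A₃ * klScale e₀ n ^ 2 ≤ a₃) (hM : klScale e₀ n * β < π * (2 * M - 5)) (hMβ : β * e₀ ≤ M)
    (hLz : 3 * |2 * π / (L : ℝ)| * ((2 : ℝ) ^ n + 1 / 2) ≤ z) (hL16 : 2 * π * (16 : ℝ) ^ n ≤ L)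
    (hΛβ : π / (4 * β) ≤ klScale e₀ n) (c : Fin 2) :
    1 / (|β| * (L : ℝ) ^ 2) *
        ∑ dw : TorusSite 1 (2 * (2 * M)) × TorusSite 2 L,
          (1 + 2 * klScale e₀ n * β / (((2 * (2 * M) : ℕ) : ℝ) * π * Real.sqrt (κt ^ 2)) * |(((dw.1 0).valMinAbs : ℤ) : ℝ)| +
              2 * klScale e₀ n / (π * Real.sqrt Kc) * |(((dw.2 0).valMinAbs : ℤ) : ℝ)| +
              2 * klScale e₀ n / (π * Real.sqrt Kc) * |(((dw.2 1).valMinAbs : ℤ) : ℝ)|) *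
          ‖∑ k : FreqMomentum L M, klAnisoFamily L M β μ K e₀ n ω k *
            (if c = 0 then torusChar (fun _ : Fin 1 => ((k.1 : ℕ) : ZMod (2 * (2 * M)))) dw.1 * torusChar k.2 dw.2
              else conj (torusChar (fun _ : Fin 1 => ((k.1 : ℕ) : ZMod (2 * (2 * M)))) dw.1 * torusChar k.2 dw.2))‖ ≤
      1 / (|β| * (L : ℝ) ^ 2) *
        (Real.sqrt (524288 * (π * Real.sqrt (κt ^ 2) + 1) * ((1 + 12 * Real.sqrt 2) ^ 2 / 4 + 1 / 16) * κX * (240 / π * (cN1 * cN2)) / e₀) *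
          (2 * (M : ℝ)) * (L : ℝ) ^ 2) := by
  classical
  have hM3 : klScale e₀ n * β < π * (2 * M - 3) := hM.trans_le (by nlinarith [Real.pi_pos])
  -- the padded sampled symbol
  set Gs : TorusSite 1 (2 * (2 * M)) × TorusSite 2 L → ℂ := fun q =>
    if h : (q.1 0).val < 2 * M then klAnisoFamily L M β μ K e₀ n ω (⟨(q.1 0).val, h⟩, q.2) else 0 with hGsdef
  have hGs : ∀ q, Gs q = if h : (q.1 0).val < 2 * M then klAnisoFamily L M β μ K e₀ n ω (⟨(q.1 0).val, h⟩, q.2) else 0 :=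
    fun q => rfl
  have hL : (0 : ℝ) < L := Nat.cast_pos.2 (Nat.pos_of_ne_zero (NeZero.ne L))
  have hMpos : (0 : ℝ) < M := Nat.cast_pos.2 (Nat.pos_of_ne_zero (NeZero.ne M))
  have hπ := Real.pi_pos
  have hA0 : 0 ≤ A := le_trans (norm_nonneg _) (hA 0 0 (by norm_num))
  have hA30 : 0 ≤ A₃ := le_trans (norm_nonneg _) (hA3 0)
  have hlo' : a ≤ μ - A := by linarith
  have hhi' : μ + A ≤ b := by linarith
  have hc : 0 < 2 * π / (L : ℝ) := by positivity
  have habs : |2 * π / (L : ℝ)| = 2 * π / L := abs_of_pos hc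
  have hDt : 0 < B.Dtmin - 2 * A := by linarith
  have hγ : 0 < 2 * B.rhomin - 4 * A := by linarith
  -- the scale bookkeeping
  obtain ⟨hΛN2, hΛe, hΛN, hN2L, hLΛ2, hhN2⟩ := scale_facts he n hL16
  set Λ : ℝ := klScale e₀ n with hΛdef
  set N : ℝ := (2 : ℝ) ^ n with hNdef
  have hΛ : 0 < Λ := by rw [hΛdef, klScale]; positivity
  have hN1 : 1 ≤ N := one_le_pow₀ (by norm_num)
  have hN0 : 0 < N := by positivity
  -- the steps
  set U : ℝ := 2 * π / L * (N + 1 / 2) with hUdef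
  have hU0 : 0 < U := by positivity
  have hLz3 : 3 * (2 * π / (L : ℝ)) * (N + 1 / 2) ≤ z := by rw [habs] at hLz; exact hLz
  have hLz' : 2 * (2 * π / (L : ℝ)) * (N + 1 / 2) ≤ z := by
    have h0 : 0 ≤ (2 * π / (L : ℝ)) * (N + 1 / 2) := by positivity
    linarith only [hLz3, h0]
  have hU : U ≤ 1 / 2 := by rw [hUdef]; linarith only [hLz', hz1]
  have hhU : 2 * π / (L : ℝ) ≤ U := by
    rw [hUdef]
    have := mul_le_mul_of_nonneg_left (show (1 : ℝ) ≤ N + 1 / 2 by linarith only [hN1]) hc.le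
    linarith only [this]
  have hU32 : U ≤ 3 / 2 * (2 * π / (L : ℝ) * N) := by
    rw [hUdef]
    have := mul_le_mul_of_nonneg_left hN1 hc.le
    linarith only [this]
  have hLU : (L : ℝ) * U ≤ 3 * π * N := by
    rw [hUdef]
    have e : (L : ℝ) * (2 * π / L * (N + 1 / 2)) = 2 * π * (N + 1 / 2) := by field_simp
    rw [e]
    have := mul_le_mul_of_nonneg_left hN1 hπ.le
    linarith only [this]
  -- signs of the constants
  have hcT0 : 0 ≤ cT := by rw [hcT]; positivity
  have hκt1 : 1 ≤ κt := by rw [hκt]; exact le_max_left _ _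
  have hκtc : cT ≤ κt := by rw [hκt]; exact le_max_right _ _
  have hκt0 : 0 < κt := lt_of_lt_of_le one_pos hκt1
  have hsqt : Real.sqrt (κt ^ 2) = κt := Real.sqrt_sq hκt0.le
  have hcG0 : 0 < κt ^ 2 := by positivity
  have hρb0 : 0 ≤ ρb := by rw [hρb]; have := B.smax_pos; have := B.Dtmin_pos; positivity
  have hG₁0 : 0 ≤ G₁ := by rw [hG₁]; positivity
  have hK₂0 : 0 ≤ K₂ := by rw [hK₂]; positivity
  have hY0 : 0 ≤ Y₃ := by rw [hY₃]; positivity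
  have hκ₂0 : 0 ≤ κ₂ := by rw [hκ₂]; positivity
  have ha30 : 0 ≤ a₃ := le_trans (by positivity) ha3
  have hκ₃0 : 0 ≤ κ₃ := by rw [hκ₃]; positivity
  have hκ1 : 1 ≤ κ := by rw [hκ]; exact le_max_left _ _
  have hκ3 : κ₃ ≤ κ := by rw [hκ]; exact (le_max_left _ _).trans (le_max_right _ _)
  have hκ2 : κ₂ ≤ κ := by rw [hκ]; exact (le_max_right _ _).trans (le_max_right _ _)
  have hκ0 : 0 < κ := lt_of_lt_of_le one_pos hκ1
  have hK0 : 0 < Kc := by rw [hKc]; positivity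
  have hsqK : Real.sqrt Kc = κ := by rw [hKc]; exact Real.sqrt_sq hκ0.le
  have hκ2K : κ₂ ≤ Kc := by rw [hKc]; nlinarith
  have hκX0 : 0 ≤ κX := by rw [hκX]; positivity
  have hcN10 : 0 ≤ cN1 := by rw [hcN1]; positivity
  have hcN20 : 0 ≤ cN2 := by rw [hcN2]; positivity
  -- the cell radius and the angular width factor
  set ρ : ℝ := (klScale e₀ n + B.smax * B.Dtmin * (3 * sectorWidth n / 4)) / (B.Dtmin - 2 * A) with hρdef
  have hρ0 : 0 ≤ ρ := by
    have := B.smax_pos; have := B.Dtmin_pos; have := sectorWidth_pos n; positivity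
  have hρN : ρ ≤ ρb / N := by rw [hρdef, hρb]; exact cellRadius_le B hADt (Nat.le_succ n) hΛN
  obtain ⟨hDn, hDn0⟩ := one_add_six_div_sectorWidth_le n
  -- the tangent step
  set eK : (Fin 2 → ℝ) → ℝ := fun p => frameLevel μ K (WithLp.toLp 2 p) with heK
  set pF : Fin 2 → ℝ := klFermiPoint μ K (sectorCenter n (ω : ℕ)) with hpF
  have hgrad : ‖fderiv ℝ eK pF‖ ≤ 4 + 2 * A := norm_fderiv_frameBand_le hA μ pF
  have hγ' : 0 < Real.sqrt (fderiv ℝ eK pF (Pi.single 0 1) ^ 2 + fderiv ℝ eK pF (Pi.single 1 1) ^ 2) :=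
    lt_of_lt_of_le (by linarith) (gradient_floor_klFermiPoint B hA hlo' hhi' (sectorCenter n (ω : ℕ)))
  set v : Fin 2 → ℤ := ![round (N * (-fderiv ℝ eK pF (Pi.single 1 1) /
      Real.sqrt (fderiv ℝ eK pF (Pi.single 0 1) ^ 2 + fderiv ℝ eK pF (Pi.single 1 1) ^ 2))),
    round (N * (fderiv ℝ eK pF (Pi.single 0 1) /
      Real.sqrt (fderiv ℝ eK pF (Pi.single 0 1) ^ 2 + fderiv ℝ eK pF (Pi.single 1 1) ^ 2)))] with hvdef
  have hv0 : v 0 = round (N * (-fderiv ℝ eK pF (Pi.single 1 1) /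
      Real.sqrt (fderiv ℝ eK pF (Pi.single 0 1) ^ 2 + fderiv ℝ eK pF (Pi.single 1 1) ^ 2))) := by
    rw [hvdef]; rfl
  have hv1 : v 1 = round (N * (fderiv ℝ eK pF (Pi.single 0 1) /
      Real.sqrt (fderiv ℝ eK pF (Pi.single 0 1) ^ 2 + fderiv ℝ eK pF (Pi.single 1 1) ^ 2))) := by
    rw [hvdef]; rfl
  obtain ⟨hτv, hvsize, hv⟩ := tangentStep_bounds eK pF hgrad hγ' hN1 v hv0 hv1 (2 * π / L)
  have hV : N / 2 ≤ Real.sqrt ((v 0 : ℝ) ^ 2 + (v 1 : ℝ) ^ 2) := half_le_norm_tangentStep hγ' n v hv0 hv1 hv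
  obtain ⟨hR₀, hR₀'⟩ := tangentR0_bounds hN1 v hv hvsize (twelve_mul_le_of_step hL hN0 hz1 hLz')
  set R₀ : ℕ := (L - 1) / (2 * ((v 0).natAbs + (v 1).natAbs)) with hR₀def
  -- admissibility of the steps (`6π|u_j| ≤ zL`)
  have huv3 : ∀ j, 3 * |2 * π / (L : ℝ)| * |(v j : ℝ)| ≤ z := fun j =>
    (mul_le_mul_of_nonneg_left (hvsize j) (by positivity)).trans hLz
  have huv2 : ∀ j, 2 * |2 * π / (L : ℝ)| * |(v j : ℝ)| ≤ z := fun j => by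
    have h1 := huv3 j
    have h0 : 0 ≤ |2 * π / (L : ℝ)| * |(v j : ℝ)| := by positivity
    linarith only [h1, h0]
  have huax : ∀ (i j : Fin 2), 3 * |2 * π / (L : ℝ)| * |(((Pi.single i (1 : ℤ) : Fin 2 → ℤ) j : ℤ) : ℝ)| ≤ z := by
    intro i j
    have h1 : |(((Pi.single i (1 : ℤ) : Fin 2 → ℤ) j : ℤ) : ℝ)| ≤ N + 1 / 2 := by
      have : |(((Pi.single i (1 : ℤ) : Fin 2 → ℤ) j : ℤ) : ℝ)| ≤ 1 := by
        by_cases hj : j = i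
        · subst hj; simp
        · simp [hj]
      linarith only [this, hN1]
    exact (mul_le_mul_of_nonneg_left h1 (by positivity)).trans hLz
  have huperp : ∀ j, 3 * |2 * π / (L : ℝ)| * |(((![-v 1, v 0] : Fin 2 → ℤ) j : ℤ) : ℝ)| ≤ z := by
    intro j
    fin_cases j
    · simpa [abs_neg] using huv3 1
    · simpa using huv3 0
  have hWv : ‖(fun j : Fin 2 => 2 * π / L * (v j : ℝ))‖ ≤ U := by
    refine (pi_norm_le_iff_of_nonneg hU0.le).2 fun j => ?_
    rw [Real.norm_eq_abs, abs_mul, habs, hUdef]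
    exact mul_le_mul_of_nonneg_left (hvsize j) hc.le
  have hWp : ‖(fun j : Fin 2 => 2 * π / L * (((![-v 1, v 0] : Fin 2 → ℤ) j : ℤ) : ℝ))‖ ≤ U := by
    refine (pi_norm_le_iff_of_nonneg hU0.le).2 fun j => ?_
    rw [Real.norm_eq_abs, abs_mul, habs, hUdef]
    refine mul_le_mul_of_nonneg_left ?_ hc.le
    fin_cases j
    · simpa [abs_neg] using hvsize 1
    · simpa using hvsize 0
  have hWmv := norm_momToComplex_le_two_mul hU0.le _ hWv
  have hWmp := norm_momToComplex_le_two_mul hU0.le _ hWp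
  -- (0) the pointwise bounds in the master lemma's currency
  have hP0 : (0 : ℝ) < ((2 * (2 * M) : ℕ) : ℝ) := Nat.cast_pos.2 (Nat.pos_of_ne_zero (mul_ne_zero two_ne_zero (mul_ne_zero two_ne_zero (NeZero.ne M))))
  -- time, order three
  have h0' : ∀ q, ‖((fwdDiff ((fun _ : Fin 1 => (1 : ZMod (2 * (2 * M)))), (0 : TorusSite 2 L)))^[3] Gs) q‖ ≤
      1 * (4 / (2 * Λ * β / (((2 * (2 * M) : ℕ) : ℝ) * π * Real.sqrt (κt ^ 2)) * ((2 * (2 * M) : ℕ) : ℝ))) ^ 3 := by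
    intro q
    have h := norm_fwdDiff_three_time_klAnisoPadded_le hA he hz h3 hβ ω hd1 hd2 hd3 hZ hΦ hGs hM3 hM q
    refine h.trans ?_
    rw [← hcT]
    exact cu_rate_time_le (by rw [hsqt]; exact hκt1) (by rw [hsqt]; exact hκtc) hΛ hβ hP0
  -- the generic isotropic order-three packaging for a step of size `W`
  have hiso : ∀ (u : Fin 2 → ℤ) (W : ℝ), 0 ≤ W → ‖(fun j : Fin 2 => 2 * π / L * (u j : ℝ))‖ ≤ W →
      ‖momToComplex (fun j : Fin 2 => 2 * π / L * (u j : ℝ))‖ ≤ 2 * W → (∀ j, 3 * |2 * π / (L : ℝ)| * |(u j : ℝ)| ≤ z) →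
      ∀ q, ‖((fwdDiff ((0 : TorusSite 1 (2 * (2 * M))), (fun j => ((u j : ℤ) : ZMod L))))^[3] Gs) q‖ ≤ κ₃ * W ^ 3 / Λ ^ 3 := by
    intro u W hW0 hWn hWm hu q
    have hraw := norm_fwdDiff_three_space_klAnisoPadded_le hA hA3 he hz hz1 hgap h3 hβ ω hd.le hd1 hd2 hd3 hZ hΦ hGs hM3 hB0.le hB u hu q
    refine hraw.trans ?_
    rw [hκ₃, hG₁, hK₂]
    rw [hG₁, hK₂] at *
    exact iso3_pack_le (by positivity) (by positivity) (by positivity) (by positivity) (by positivity) hA30 hB0.le hΛ hN0.le hW0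
      (norm_nonneg _) hWn (norm_nonneg _) hWm hDn0 hDn hΛe hΛN ha3
  -- axes, order three
  have h1' : ∀ q (i : Fin 2), ‖((fwdDiff ((0 : TorusSite 1 (2 * (2 * M))), (Pi.single i (1 : ZMod L) : TorusSite 2 L)))^[3] Gs) q‖ ≤
      1 * (4 / (2 * Λ / (π * Real.sqrt Kc) * L)) ^ 3 := by
    intro q i
    have h := hiso (Pi.single i 1) (2 * π / L) hc.le (le_of_eq (norms_axisStep L i).1)
      (by rw [(norms_axisStep L i).2]; linarith only [hc]) (huax i) q
    rw [axisStep_cast] at h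
    refine h.trans ?_
    exact cu_rate_space_le (by rw [hsqK]; exact hκ1) (by rw [hsqK]; exact hκ3) hΛ hL
  -- the normal step, order three
  have h2' : ∀ q, ‖((fwdDiff ((0 : TorusSite 1 (2 * (2 * M))), (fun j => ((((![-v 1, v 0] : Fin 2 → ℤ) j : ℤ)) : ZMod L))))^[3] Gs) q‖ ≤
      1 * (4 / (4 * Λ / (L * U * Real.sqrt Kc) * L)) ^ 3 := by
    intro q
    have h := hiso (![-v 1, v 0]) U hU0.le hWp hWmp huperp q
    refine h.trans ?_
    exact cu_rate_perp_le (by rw [hsqK]; exact hκ1) (by rw [hsqK]; exact hκ3) hΛ hL hU0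
  -- the tangent step, order three (isotropic rate)
  have h3'' : ∀ q, ‖((fwdDiff ((0 : TorusSite 1 (2 * (2 * M))), (fun j => ((v j : ℤ) : ZMod L))))^[3] Gs) q‖ ≤
      1 * (4 / (4 * Λ / (L * U * Real.sqrt Kc) * L)) ^ 3 := by
    intro q
    have h := hiso v U hU0.le hWv hWmv huv3 q
    refine h.trans ?_
    exact cu_rate_perp_le (by rw [hsqK]; exact hκ1) (by rw [hsqK]; exact hκ3) hΛ hL hU0
  -- the tangent step, order two (anisotropic rate, tangency datum)
  have h3' : ∀ q, ‖((fwdDiff ((0 : TorusSite 1 (2 * (2 * M))), (fun j => ((v j : ℤ) : ZMod L))))^[2] Gs) q‖ ≤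
      1 * (4 / (2 * Λ / (π * Real.sqrt Kc) * L)) ^ 2 := by
    intro q
    have hraw := norm_fwdDiff_two_space_klAnisoPadded_le B hA hADt he hz hz1 hgap h3 hlo hhi hβ ω hd.le hd1 hd2 hZ hΦ hGs hM3 hB0.le hB v huv2 hτv q
    refine hraw.trans ?_
    rw [← hρdef, habs]
    set Wn : ℝ := ‖(fun j : Fin 2 => 2 * π / L * (v j : ℝ))‖ with hWndef
    set Wm : ℝ := ‖momToComplex (fun j : Fin 2 => 2 * π / L * (v j : ℝ))‖ with hWmdef
    have hWn0 : 0 ≤ Wn := norm_nonneg _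
    have hWm0 : 0 ≤ Wm := norm_nonneg _
    have hWnN : Wn ≤ 3 / 2 * (2 * π / L * N) := hWv.trans hU32
    have hWmN : Wm ≤ 3 * (2 * π / L * N) := hWmv.trans (by linarith only [hU32])
    have hpack := tan2_pack_le (g₁ := d * e₀ ^ 2) (g₂ := d * e₀ ^ 4) (G₁ := 4 + 2 * A) (K₂ := 4 + 4 * A) (B := Ba) (e₀ := e₀)
      (h := 2 * π / L) (ρ := ρ) (ρb := ρb) (Wn := Wn) (Wm := Wm) (Dn := 1 + 6 * (sectorWidth n)⁻¹)
      (by positivity) (by positivity) (by positivity) (by positivity) hB0.le hΛ hN1 hc hρ0 hρN hρb0 hWn0 hWnN hWm0 hWmN hDn0 hDn hhN2 hΛN2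
    have e1 : 2 * π / L * (4 + 2 * A) = (2 * π / L) * (4 + 2 * A) := rfl
    refine (le_of_eq ?_).trans (hpack.trans ?_)
    · ring
    · rw [← hG₁, ← hK₂, ← hY₃]
      have eκ : (4 * (d * e₀ ^ 4) + 2 * (d * e₀ ^ 2)) * Y₃ ^ 2 + 9 / 2 * (d * e₀ ^ 2) * K₂ * e₀ + 216 * (d * e₀ ^ 2) * Ba * Y₃ * e₀ +
          486 * Ba * e₀ ^ 2 = κ₂ := by rw [hκ₂]
      rw [eκ]
      have h := sq_rate_space_le hK0 hκ2K hΛ hL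
      calc κ₂ * (2 * π / L) ^ 2 / Λ ^ 2 = (2 * π / L) ^ 2 * κ₂ / Λ ^ 2 := by ring
        _ ≤ _ := h
  -- support
  have hNs := card_support_klAnisoPadded_le B hA hADt he hz hz1 hgap h3 hlo hhi hβ hρA ω hd1 hd2 hZ hΦ hGs hM3
  rw [← hρdef] at hNs
  -- the door `torusSumWt_le_of_symbol_bounds_mixed` at the clean rates (one-member family)
  have hs₀ : 0 < 2 * Λ * β / (((2 * (2 * M) : ℕ) : ℝ) * π * Real.sqrt (κt ^ 2)) := by rw [hsqt]; positivity
  have hsK : 0 < Real.sqrt Kc := by rw [hsqK]; exact hκ0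
  have hs₁ : 0 < 2 * Λ / (π * Real.sqrt Kc) := by positivity
  have hs₂ : 0 < 4 * Λ / (L * U * Real.sqrt Kc) := by positivity
  have hreal : ∀ (ω' : Fin 1) (k : FreqMomentum L M),
      conj ((fun _ : Fin 1 => klAnisoFamily L M β μ K e₀ n ω) ω' k) = (fun _ : Fin 1 => klAnisoFamily L M β μ K e₀ n ω) ω' k :=
    fun _ k => EngineV8.conj_klAnisoFamily β μ K e₀ n ω k
  have hF1 : ∀ (ω' : Fin 1) (k : FreqMomentum L M), ‖(fun _ : Fin 1 => klAnisoFamily L M β μ K e₀ n ω) ω' k‖ ≤ 1 := by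
    intro _ k
    simp only [klAnisoFamily, bgmMultiplier, Complex.norm_real, Real.norm_eq_abs]
    have h1 := gnScaleCutoff_mem_Icc 4 e₀ (-(n : ℤ)) (Real.sqrt (matsubaraFreq β M k.1 ^ 2 + nambuXiCT L μ K k.2 ^ 2))
    have h2 : 0 ≤ sectorWeightCirc n ((ω : ℕ) : ℤ) (momentumAngle L k.2) ∧ sectorWeightCirc n ((ω : ℕ) : ℤ) (momentumAngle L k.2) ≤ 1 :=
      ⟨sectorWeightCirc_nonneg _ _ _, sectorWeightCirc_le_one _ _ _⟩
    rw [abs_of_nonneg (mul_nonneg h1.1 h2.1)]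
    exact mul_le_one₀ h1.2 h2.1 h2.2
  have main := EngineV8.torusSumWt_le_of_symbol_bounds_mixed β (fun _ : Fin 1 => klAnisoFamily L M β μ K e₀ n ω) hreal hF1 v hv
    hs₀ hs₁ hs₂ hs₁ hs₂ hR₀ (fun _ => le_rfl) (fun _ q => (h0' q).trans (le_of_eq (one_mul _)))
    (fun _ q i => (h1' q i).trans (le_of_eq (one_mul _))) (fun _ q => (h2' q).trans (le_of_eq (one_mul _)))
    (fun _ q => (h3' q).trans (le_of_eq (one_mul _))) (fun _ q => (h3'' q).trans (le_of_eq (one_mul _))) 0 c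
  refine main.trans (mul_le_mul_of_nonneg_left ?_ (by positivity))
  -- the final bookkeeping
  have hP : ((2 * (2 * M) : ℕ) : ℝ) = 2 * (2 * (M : ℝ)) := by push_cast; ring
  rw [hP]
  have hΛβM : Λ * β ≤ M := (mul_le_mul_of_nonneg_right hΛe hβ.le).trans (by rw [mul_comm]; exact hMβ)
  have hM2pos : (0 : ℝ) < 2 * (M : ℝ) := by positivity
  have hΛβM2 : Λ * β ≤ 2 * (M : ℝ) := by linarith only [hΛβM, hMpos]
  have htfac : 1 / (2 * Λ * β / (2 * (2 * (M : ℝ)) * π * Real.sqrt (κt ^ 2))) + 1 ≤ 2 * (M : ℝ) / (Λ * β) * (π * Real.sqrt (κt ^ 2) + 1) :=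
    tfac_le hcG0 hΛ hβ hM2pos hΛβM2
  have hnear2 := near_perp_le (V := Real.sqrt ((v 0 : ℝ) ^ 2 + (v 1 : ℝ) ^ 2)) hK0 hΛ hL hU0 hN0 hV hLU hΛe
  have hnear3 := near_tan_le (V := Real.sqrt ((v 0 : ℝ) ^ 2 + (v 1 : ℝ) ^ 2)) hK0 hΛ hN0 hV hΛN
  have hfar := far_le (R₀ := (R₀ : ℝ)) hK0 hΛ hL hN0 he hΛe hR₀' hLΛ2
  have hn2 : 0 ≤ 2 * Real.sqrt 2 / (4 * Λ / (L * U * Real.sqrt Kc) * Real.sqrt ((v 0 : ℝ) ^ 2 + (v 1 : ℝ) ^ 2)) + 2 := by positivity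
  have hn3 : 0 ≤ 2 * Real.sqrt 2 / (2 * Λ / (π * Real.sqrt Kc) * Real.sqrt ((v 0 : ℝ) ^ 2 + (v 1 : ℝ) ^ 2)) + 2 := by positivity
  have hbr := bracket_le hΛ hN0 hΛN2 hn3 hnear2 hnear3 hfar
  rw [← hκX] at hbr
  -- the moment constant
  have hV0 : 0 < Real.sqrt ((v 0 : ℝ) ^ 2 + (v 1 : ℝ) ^ 2) := lt_of_lt_of_le (by positivity) hV
  have hratio := cw_ratio_le (V := Real.sqrt ((v 0 : ℝ) ^ 2 + (v 1 : ℝ) ^ 2)) hsK hΛ hL hU0 hN0 hV hLU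
  have hCw : 1 + 2 * Real.sqrt 2 * (2 * Λ / (π * Real.sqrt Kc)) / (4 * Λ / (L * U * Real.sqrt Kc) * Real.sqrt ((v 0 : ℝ) ^ 2 + (v 1 : ℝ) ^ 2)) +
      2 * Real.sqrt 2 * (2 * Λ / (π * Real.sqrt Kc)) / (4 * Λ / (L * U * Real.sqrt Kc) * Real.sqrt ((v 0 : ℝ) ^ 2 + (v 1 : ℝ) ^ 2)) ≤
      1 + 12 * Real.sqrt 2 := by linarith only [hratio]
  have hCw0 : 0 ≤ 1 + 2 * Real.sqrt 2 * (2 * Λ / (π * Real.sqrt Kc)) / (4 * Λ / (L * U * Real.sqrt Kc) * Real.sqrt ((v 0 : ℝ) ^ 2 + (v 1 : ℝ) ^ 2)) +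
      2 * Real.sqrt 2 * (2 * Λ / (π * Real.sqrt Kc)) / (4 * Λ / (L * U * Real.sqrt Kc) * Real.sqrt ((v 0 : ℝ) ^ 2 + (v 1 : ℝ) ^ 2)) := by
    positivity
  have hfr0 : 0 ≤ 16 * (1 / (2 * Λ / (π * Real.sqrt Kc)) + 1) ^ 2 / (1 + 2 * Λ / (π * Real.sqrt Kc) * (R₀ : ℝ)) := by positivity
  have hbrW := bracketWt_le (C₀ := 1 + 12 * Real.sqrt 2) hCw0 hCw hn2 hn3 hfr0
  have hX1 : 524288 * (1 / (2 * Λ * β / (2 * (2 * (M : ℝ)) * π * Real.sqrt (κt ^ 2))) + 1) *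
      ((1 + 2 * Real.sqrt 2 * (2 * Λ / (π * Real.sqrt Kc)) / (4 * Λ / (L * U * Real.sqrt Kc) * Real.sqrt ((v 0 : ℝ) ^ 2 + (v 1 : ℝ) ^ 2)) +
          2 * Real.sqrt 2 * (2 * Λ / (π * Real.sqrt Kc)) / (4 * Λ / (L * U * Real.sqrt Kc) * Real.sqrt ((v 0 : ℝ) ^ 2 + (v 1 : ℝ) ^ 2))) ^ 2 *
        ((2 * Real.sqrt 2 / (4 * Λ / (L * U * Real.sqrt Kc) * Real.sqrt ((v 0 : ℝ) ^ 2 + (v 1 : ℝ) ^ 2)) + 2) *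
          (2 * Real.sqrt 2 / (2 * Λ / (π * Real.sqrt Kc) * Real.sqrt ((v 0 : ℝ) ^ 2 + (v 1 : ℝ) ^ 2)) + 2)) +
        (1 / (2 * Λ / (π * Real.sqrt Kc)) + 1) ^ 2 / (1 + 2 * Λ / (π * Real.sqrt Kc) * (R₀ : ℝ))) ≤
      524288 * (π * Real.sqrt (κt ^ 2) + 1) * ((1 + 12 * Real.sqrt 2) ^ 2 / 4 + 1 / 16) * κX * (2 * (M : ℝ) / (Λ * β)) * (N / Λ) := by
    have hfr16 : (1 / (2 * Λ / (π * Real.sqrt Kc)) + 1) ^ 2 / (1 + 2 * Λ / (π * Real.sqrt Kc) * (R₀ : ℝ)) =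
        (16 * (1 / (2 * Λ / (π * Real.sqrt Kc)) + 1) ^ 2 / (1 + 2 * Λ / (π * Real.sqrt Kc) * (R₀ : ℝ))) / 16 := by ring
    rw [hfr16]
    have hbr2 := hbrW.trans (mul_le_mul_of_nonneg_left hbr (by positivity))
    calc _ ≤ 524288 * (2 * (M : ℝ) / (Λ * β) * (π * Real.sqrt (κt ^ 2) + 1)) * (((1 + 12 * Real.sqrt 2) ^ 2 / 4 + 1 / 16) * (N / Λ * κX)) := by
          gcongr
      _ = _ := by ring
  have hsupp := supp_le (K₂ := 4 + 4 * A) (γ := 2 * B.rhomin - 4 * A) hΛ hβ hL hN1 hρ0 hρN (by linarith) hγ hΛN2 hN2L hΛβ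
  rw [← hcN1, ← hcN2] at hsupp
  have hX2 : 24 * (2 * (2 * (M : ℝ))) * (L : ℝ) ^ 2 *
      ((((univ : Finset (TorusSite 1 (2 * (2 * M)) × TorusSite 2 L)).filter fun q => Gs q ≠ 0).card : ℕ) : ℝ) ≤
      240 / π * (cN1 * cN2) * (2 * (M : ℝ)) * (Λ * β) * ((L : ℝ) ^ 2 * ((L : ℝ) ^ 2 / N ^ 3)) := by
    calc _ ≤ 24 * (2 * (2 * (M : ℝ))) * (L : ℝ) ^ 2 * (5 * Λ * β / π * ((L : ℝ) ^ 2 / N ^ 3) * (cN1 * cN2)) := by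
          gcongr; exact hNs.trans hsupp
      _ = 240 / π * (cN1 * cN2) * (2 * (M : ℝ)) * (Λ * β) * ((L : ℝ) ^ 2 * ((L : ℝ) ^ 2 / N ^ 3)) := by ring
  have hfin := sqrt_mul_sqrt_le (a := 524288 * (π * Real.sqrt (κt ^ 2) + 1) * ((1 + 12 * Real.sqrt 2) ^ 2 / 4 + 1 / 16) * κX)
    (b := 240 / π * (cN1 * cN2)) (N := N) (Λ := Λ) (β := β)
    (by positivity) (by positivity) (by positivity) (by positivity) hM2pos.le hΛ hβ hN0 hΛN2 hX1 hX2
  rw [mul_one] at hfin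
  exact hfin

end Main

end Summit.HubbardSuperconductivity.HubbardSuperconductivity.Theorems.TorusFourierL2

end
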